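import Summits.ValiantsHypothesis.ValiantsHypothesis.Theorems.PolyaContinuedMonotoneCoverHardLabelLevelled
import Summits.ValiantsHypothesis.ValiantsHypothesis.Theorems.PolyaContinuedMonotoneCoverHardWidthBet

/-!
# Crux `MonotoneCoverHard` (stmt-ValiantsHypothesis-7421), line `width_cut` — the crux is REDUCED IN
KERNEL TO WIDE COVERS: `WideWidthBet → WidthBet → MonotoneCoverHard`

(val-width-7421-p4 g0, 2026-08-28.)

The registered stub `stub_width` of line `width_cut` is the WIDTH BET (`…WidthBet.lean`,
`monotoneCoverHard_of_widthBet`).  A cover all of whose widths are `≤ 2` satisfies the bet's conclusion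
outright (`exists_balanced_level`, `varCount_eq`, `belowCount_eq` on the used-edge sub-cover — the
content of val-width-7421-p2's width-two rung).  So the bet need only be assumed for WIDE covers
(some weight-nonzero perfect matching has `≥ 3` variable edges leaving one row level):

* `widthBet_of_wideWidthBet` — the width bet restricted to wide covers implies the full width bet
  (`d ↦ d + 2`, `n₀ ↦ n₀ + 7`);
* `monotoneCoverHard_of_wideWidthBet` — hence implies the crux `MonotoneCoverHard` BY NAME.

This is the WEAKEST single stub for the line (companion: `…MixingBet.lean`, the same with "level-mixing"
in place of "wide"; wide ⇒ level-mixing by `false_of_pure_fiber`, and what is known about wide covers is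
in `…PureFiber`, `…FiberLanes`, `…FiberSpread`, `…LateReaders`).  VP ≠ VNP is not moved;
`MonotoneCoverHard` stays open (exactly for wide, hence level-mixing, Pfaffian covers).  No definitions.
-/

namespace Summit.ValiantsHypothesis.ValiantsHypothesis.Theorems.PolyaContinuedMonotoneCoverHard

-- summit = sub-problem name (single-conjunct summit, D-0017 layout), so the namespace repeats it
set_option linter.dupNamespace false

open scoped Classical
open Finset
open Literature.Computability.AlgebraicComplexity (perPoly)
open Summit.ValiantsHypothesis.ValiantsHypothesis.Theses.PolyaContinued (MonotoneCoverHard)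

/-- **Wide width bet ⇒ width bet.**  If the width bet holds for all WIDE label-bijective Pfaffian
covers (some weight-nonzero perfect matching has at least three variable edges leaving one row
level), then it holds for all label-bijective Pfaffian covers. -/
theorem widthBet_of_wideWidthBet
    (hmix : ∃ d n₀ : ℕ, ∀ (n m : ℕ) (E : Finset (Fin m × Fin m))
      (a : Fin m × Fin m → MvPolynomial (Fin n × Fin n) ℂ), n₀ ≤ n →
      (∃ s : Fin m × Fin m → ℂ, (∀ e, s e = 1 ∨ s e = -1) ∧
        (Matrix.of fun i j => if (i, j) ∈ E then MvPolynomial.C (s (i, j)) * MvPolynomial.X (i, j)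
            else 0 : Matrix (Fin m) (Fin m) (MvPolynomial (Fin m × Fin m) ℂ)).det =
          (Matrix.of fun i j => if (i, j) ∈ E then MvPolynomial.X (i, j) else 0 :
            Matrix (Fin m) (Fin m) (MvPolynomial (Fin m × Fin m) ℂ)).permanent) →
      (∀ e, (∃ j, a e = MvPolynomial.X j) ∨ a e = 0 ∨ a e = 1) →
      perPoly (Fin n) ℂ =
        MvPolynomial.aeval a (Matrix.of fun i j => if (i, j) ∈ E then MvPolynomial.X (i, j) else 0 :
            Matrix (Fin m) (Fin m) (MvPolynomial (Fin m × Fin m) ℂ)).permanent →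
      ∀ g : Fin m ⊕ Fin m → ℕ,
        (∀ τ : Equiv.Perm (Fin m), (∀ i, (i, τ i) ∈ E ∧ a (i, τ i) ≠ 0) → ∀ i,
          (∃ k, a (i, τ i) = MvPolynomial.X k) → g (Sum.inr (τ i)) = g (Sum.inl i) + 1) →
        (∀ τ : Equiv.Perm (Fin m), (∀ i, (i, τ i) ∈ E ∧ a (i, τ i) ≠ 0) → ∀ i,
          (¬ ∃ k, a (i, τ i) = MvPolynomial.X k) → g (Sum.inr (τ i)) = g (Sum.inl i)) →
        (∃ τ : Equiv.Perm (Fin m), (∀ i, (i, τ i) ∈ E ∧ a (i, τ i) ≠ 0) ∧ ∃ ℓ : ℕ,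
          3 ≤ (Finset.univ.filter fun i : Fin m =>
            (∃ k, a (i, τ i) = MvPolynomial.X k) ∧ g (Sum.inl i) = ℓ).card) →
        ∃ h ch cq : ℕ, 1 ≤ h ∧
          (∀ τ : Equiv.Perm (Fin m), (∀ i, (i, τ i) ∈ E ∧ a (i, τ i) ≠ 0) →
            n ≤ 3 * (Finset.univ.filter fun i : Fin m =>
                (∃ k, a (i, τ i) = MvPolynomial.X k) ∧ g (Sum.inl i) < h).card ∧
              3 * (Finset.univ.filter fun i : Fin m =>
                (∃ k, a (i, τ i) = MvPolynomial.X k) ∧ g (Sum.inl i) < h).card ≤ 2 * n) ∧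
          (∀ τ : Equiv.Perm (Fin m), (∀ i, (i, τ i) ∈ E ∧ a (i, τ i) ≠ 0) →
            (Finset.univ.filter fun i : Fin m =>
              (∃ k, a (i, τ i) = MvPolynomial.X k) ∧ g (Sum.inl i) = h).card = ch) ∧
          (∀ τ : Equiv.Perm (Fin m), (∀ i, (i, τ i) ∈ E ∧ a (i, τ i) ≠ 0) →
            (Finset.univ.filter fun i : Fin m =>
              (∃ k, a (i, τ i) = MvPolynomial.X k) ∧ g (Sum.inl i) = h - 1).card = cq) ∧
          ch + cq ≤ (Nat.log 2 m + d) ^ d) :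
    ∃ d n₀ : ℕ, ∀ (n m : ℕ) (E : Finset (Fin m × Fin m))
      (a : Fin m × Fin m → MvPolynomial (Fin n × Fin n) ℂ), n₀ ≤ n →
      (∃ s : Fin m × Fin m → ℂ, (∀ e, s e = 1 ∨ s e = -1) ∧
        (Matrix.of fun i j => if (i, j) ∈ E then MvPolynomial.C (s (i, j)) * MvPolynomial.X (i, j)
            else 0 : Matrix (Fin m) (Fin m) (MvPolynomial (Fin m × Fin m) ℂ)).det =
          (Matrix.of fun i j => if (i, j) ∈ E then MvPolynomial.X (i, j) else 0 :
            Matrix (Fin m) (Fin m) (MvPolynomial (Fin m × Fin m) ℂ)).permanent) →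
      (∀ e, (∃ j, a e = MvPolynomial.X j) ∨ a e = 0 ∨ a e = 1) →
      perPoly (Fin n) ℂ =
        MvPolynomial.aeval a (Matrix.of fun i j => if (i, j) ∈ E then MvPolynomial.X (i, j) else 0 :
            Matrix (Fin m) (Fin m) (MvPolynomial (Fin m × Fin m) ℂ)).permanent →
      ∀ g : Fin m ⊕ Fin m → ℕ,
        (∀ τ : Equiv.Perm (Fin m), (∀ i, (i, τ i) ∈ E ∧ a (i, τ i) ≠ 0) → ∀ i,
          (∃ k, a (i, τ i) = MvPolynomial.X k) → g (Sum.inr (τ i)) = g (Sum.inl i) + 1) →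
        (∀ τ : Equiv.Perm (Fin m), (∀ i, (i, τ i) ∈ E ∧ a (i, τ i) ≠ 0) → ∀ i,
          (¬ ∃ k, a (i, τ i) = MvPolynomial.X k) → g (Sum.inr (τ i)) = g (Sum.inl i)) →
        ∃ h ch cq : ℕ, 1 ≤ h ∧
          (∀ τ : Equiv.Perm (Fin m), (∀ i, (i, τ i) ∈ E ∧ a (i, τ i) ≠ 0) →
            n ≤ 3 * (Finset.univ.filter fun i : Fin m =>
                (∃ k, a (i, τ i) = MvPolynomial.X k) ∧ g (Sum.inl i) < h).card ∧
              3 * (Finset.univ.filter fun i : Fin m =>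
                (∃ k, a (i, τ i) = MvPolynomial.X k) ∧ g (Sum.inl i) < h).card ≤ 2 * n) ∧
          (∀ τ : Equiv.Perm (Fin m), (∀ i, (i, τ i) ∈ E ∧ a (i, τ i) ≠ 0) →
            (Finset.univ.filter fun i : Fin m =>
              (∃ k, a (i, τ i) = MvPolynomial.X k) ∧ g (Sum.inl i) = h).card = ch) ∧
          (∀ τ : Equiv.Perm (Fin m), (∀ i, (i, τ i) ∈ E ∧ a (i, τ i) ≠ 0) →
            (Finset.univ.filter fun i : Fin m =>
              (∃ k, a (i, τ i) = MvPolynomial.X k) ∧ g (Sum.inl i) = h - 1).card = cq) ∧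
          ch + cq ≤ (Nat.log 2 m + d) ^ d := by
  obtain ⟨d, n₀, hd⟩ := hmix
  refine ⟨d + 2, n₀ + 7, ?_⟩
  intro n m E a hn hsig ha hper g hg1 hg0
  by_cases hmx : ∃ τ : Equiv.Perm (Fin m), (∀ i, (i, τ i) ∈ E ∧ a (i, τ i) ≠ 0) ∧ ∃ ℓ : ℕ,
      3 ≤ (Finset.univ.filter fun i : Fin m =>
        (∃ k, a (i, τ i) = MvPolynomial.X k) ∧ g (Sum.inl i) = ℓ).card
  · -- a wide cover: the hypothesis applies (with a weaker exponent)
    obtain ⟨h, ch, cq, h1, hbal, hch, hcq, hle⟩ := hd n m E a (by omega) hsig ha hper g hg1 hg0 hmx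
    refine ⟨h, ch, cq, h1, hbal, hch, hcq, hle.trans ?_⟩
    calc (Nat.log 2 m + d) ^ d ≤ (Nat.log 2 m + (d + 2)) ^ d := Nat.pow_le_pow_left (by omega) d
      _ ≤ (Nat.log 2 m + (d + 2)) ^ (d + 2) := Nat.pow_le_pow_right (by omega) (by omega)
  -- otherwise every width is `≤ 2`
  push Not at hmx
  have hwidth : ∀ τ : Equiv.Perm (Fin m), (∀ i, (i, τ i) ∈ E ∧ a (i, τ i) ≠ 0) → ∀ ℓ,
      (univ.filter fun i : Fin m =>
        (∃ k, a (i, τ i) = MvPolynomial.X k) ∧ g (Sum.inl i) = ℓ).card ≤ 2 := by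
    intro τ hτ ℓ
    have := hmx τ hτ ℓ
    omega
  -- the used-edge sub-cover: every nonzero edge used, so the level hypotheses hold edge-wise
  set Eu := E.filter (fun e => a e ≠ 0 ∧ ∃ σ : Equiv.Perm (Fin m),
    (∀ k, (k, σ k) ∈ E ∧ a (k, σ k) ≠ 0) ∧ σ e.1 = e.2) with hEu
  have hgood : ∀ τ : Equiv.Perm (Fin m), (∀ i, (i, τ i) ∈ Eu ∧ a (i, τ i) ≠ 0) ↔
      (∀ i, (i, τ i) ∈ E ∧ a (i, τ i) ≠ 0) := good_usedEdges_iff E a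
  have hvaru : ∀ i j, (i, j) ∈ Eu → (∃ k, a (i, j) = MvPolynomial.X k) →
      g (Sum.inr j) = g (Sum.inl i) + 1 := by
    intro i j hij hv
    obtain ⟨σ, hσ, hσi⟩ := used_usedEdges E a i j hij
    subst hσi
    exact hg1 σ ((hgood σ).1 hσ) i hv
  have honeu : ∀ i j, (i, j) ∈ Eu → a (i, j) ≠ 0 → (¬ ∃ k, a (i, j) = MvPolynomial.X k) →
      g (Sum.inr j) = g (Sum.inl i) := by
    intro i j hij _ hv
    obtain ⟨σ, hσ, hσi⟩ := used_usedEdges E a i j hij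
    subst hσi
    exact hg0 σ ((hgood σ).1 hσ) i hv
  -- a balanced level for one matching, transferred to all
  obtain ⟨τ₀, hτ₀, -⟩ := exists_good_of_perm E a ha hper 1
  have htot := card_var_eq E a ha hper τ₀ hτ₀
  obtain ⟨h, h1, hlo, hhi⟩ := exists_balanced_level a g τ₀ (by omega) htot
    (fun ℓ => by have := hwidth τ₀ hτ₀ ℓ; omega)
  refine ⟨h, (univ.filter fun i : Fin m =>
      (∃ k, a (i, τ₀ i) = MvPolynomial.X k) ∧ g (Sum.inl i) = h).card,
    (univ.filter fun i : Fin m =>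
      (∃ k, a (i, τ₀ i) = MvPolynomial.X k) ∧ g (Sum.inl i) = h - 1).card, h1, ?_, ?_, ?_, ?_⟩
  · intro τ hτ
    rw [belowCount_eq Eu a g hvaru honeu τ τ₀ ((hgood τ).2 hτ) ((hgood τ₀).2 hτ₀) h]
    exact ⟨hlo, hhi⟩
  · intro τ hτ
    exact varCount_eq Eu a g hvaru honeu τ τ₀ ((hgood τ).2 hτ) ((hgood τ₀).2 hτ₀) h
  · intro τ hτ
    exact varCount_eq Eu a g hvaru honeu τ τ₀ ((hgood τ).2 hτ) ((hgood τ₀).2 hτ₀) (h - 1)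
  · have hw1 := hwidth τ₀ hτ₀ h
    have hw2 := hwidth τ₀ hτ₀ (h - 1)
    have h2 : 2 ≤ Nat.log 2 m + (d + 2) := by omega
    calc (univ.filter fun i : Fin m =>
            (∃ k, a (i, τ₀ i) = MvPolynomial.X k) ∧ g (Sum.inl i) = h).card +
          (univ.filter fun i : Fin m =>
            (∃ k, a (i, τ₀ i) = MvPolynomial.X k) ∧ g (Sum.inl i) = h - 1).card
        ≤ 2 ^ 2 := by omega
      _ ≤ (Nat.log 2 m + (d + 2)) ^ 2 := Nat.pow_le_pow_left h2 2
      _ ≤ (Nat.log 2 m + (d + 2)) ^ (d + 2) := Nat.pow_le_pow_right (by omega) (by omega)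

/-- **The crux is reduced to wide covers**: the width bet for wide label-bijective Pfaffian covers
implies `MonotoneCoverHard` (by name). -/
theorem monotoneCoverHard_of_wideWidthBet
    (hmix : ∃ d n₀ : ℕ, ∀ (n m : ℕ) (E : Finset (Fin m × Fin m))
      (a : Fin m × Fin m → MvPolynomial (Fin n × Fin n) ℂ), n₀ ≤ n →
      (∃ s : Fin m × Fin m → ℂ, (∀ e, s e = 1 ∨ s e = -1) ∧
        (Matrix.of fun i j => if (i, j) ∈ E then MvPolynomial.C (s (i, j)) * MvPolynomial.X (i, j)
            else 0 : Matrix (Fin m) (Fin m) (MvPolynomial (Fin m × Fin m) ℂ)).det =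
          (Matrix.of fun i j => if (i, j) ∈ E then MvPolynomial.X (i, j) else 0 :
            Matrix (Fin m) (Fin m) (MvPolynomial (Fin m × Fin m) ℂ)).permanent) →
      (∀ e, (∃ j, a e = MvPolynomial.X j) ∨ a e = 0 ∨ a e = 1) →
      perPoly (Fin n) ℂ =
        MvPolynomial.aeval a (Matrix.of fun i j => if (i, j) ∈ E then MvPolynomial.X (i, j) else 0 :
            Matrix (Fin m) (Fin m) (MvPolynomial (Fin m × Fin m) ℂ)).permanent →
      ∀ g : Fin m ⊕ Fin m → ℕ,
        (∀ τ : Equiv.Perm (Fin m), (∀ i, (i, τ i) ∈ E ∧ a (i, τ i) ≠ 0) → ∀ i,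
          (∃ k, a (i, τ i) = MvPolynomial.X k) → g (Sum.inr (τ i)) = g (Sum.inl i) + 1) →
        (∀ τ : Equiv.Perm (Fin m), (∀ i, (i, τ i) ∈ E ∧ a (i, τ i) ≠ 0) → ∀ i,
          (¬ ∃ k, a (i, τ i) = MvPolynomial.X k) → g (Sum.inr (τ i)) = g (Sum.inl i)) →
        (∃ τ : Equiv.Perm (Fin m), (∀ i, (i, τ i) ∈ E ∧ a (i, τ i) ≠ 0) ∧ ∃ ℓ : ℕ,
          3 ≤ (Finset.univ.filter fun i : Fin m =>
            (∃ k, a (i, τ i) = MvPolynomial.X k) ∧ g (Sum.inl i) = ℓ).card) →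
        ∃ h ch cq : ℕ, 1 ≤ h ∧
          (∀ τ : Equiv.Perm (Fin m), (∀ i, (i, τ i) ∈ E ∧ a (i, τ i) ≠ 0) →
            n ≤ 3 * (Finset.univ.filter fun i : Fin m =>
                (∃ k, a (i, τ i) = MvPolynomial.X k) ∧ g (Sum.inl i) < h).card ∧
              3 * (Finset.univ.filter fun i : Fin m =>
                (∃ k, a (i, τ i) = MvPolynomial.X k) ∧ g (Sum.inl i) < h).card ≤ 2 * n) ∧
          (∀ τ : Equiv.Perm (Fin m), (∀ i, (i, τ i) ∈ E ∧ a (i, τ i) ≠ 0) →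
            (Finset.univ.filter fun i : Fin m =>
              (∃ k, a (i, τ i) = MvPolynomial.X k) ∧ g (Sum.inl i) = h).card = ch) ∧
          (∀ τ : Equiv.Perm (Fin m), (∀ i, (i, τ i) ∈ E ∧ a (i, τ i) ≠ 0) →
            (Finset.univ.filter fun i : Fin m =>
              (∃ k, a (i, τ i) = MvPolynomial.X k) ∧ g (Sum.inl i) = h - 1).card = cq) ∧
          ch + cq ≤ (Nat.log 2 m + d) ^ d) :
    MonotoneCoverHard :=
  monotoneCoverHard_of_widthBet (widthBet_of_wideWidthBet hmix)

end Summit.ValiantsHypothesis.ValiantsHypothesis.Theorems.PolyaContinuedMonotoneCoverHard
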